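import Mathlib
import Summits.QuantumFields.YangMills.Theorems.ConvexGribovBodyContinuumLegGivenGapStubRpCoreA
import Summits.QuantumFields.YangMills.Theorems.ConvexGribovBodyContinuumLegGivenGapStubObsGeometry
import Summits.QuantumFields.YangMills.Theorems.ConvexGribovBodyContinuumLegGivenGapStubAlongSequence
import Summits.QuantumFields.YangMills.Theorems.FradkinShenkerFlowClusteringToYangMillsStubReconstructibleGeometry
import Literature.MathematicalPhysics.QuantumFieldTheory.QCDTorusTranslation
import Literature.MathematicalPhysics.QuantumFieldTheory.LatticeMassGap
import HarnessLib

/-!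
# `ContinuumLegGivenGap` (stmt-QuantumFields-15828), line `Sketch` (reshape 17-RP) — the registered stub `stub_rpCore`:
# the reflection-positivity core at one coupling

Support file for the crux item stmt-QuantumFields-15828 (routes `ConvexGribovBody` / `SmallCircleAnchor` /
`HyperbolicRegulator` / `ContractibleFibre`), line `Sketch`, reshape 17-RP of the continuation lead c5: the IR stub
`stub_twoSidedCore` of reshapes 9–16 (crux stmt-9443's finite-size core: "every admissible rate is re-admissible at a
fixed fraction with β-FREE pair constants above a β-dependent pair-free volume threshold") is REPLACED by the
reflection-positivity core `stub_rpCore` proved here — β-free constants at HALF the rate above a β- and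
BOX-dependent threshold — from which the landed `stub_lockOfRpCore` builds the locked IR datum of the line.

**Statement.** At every `(G, r)` there are β-free pair constants
`C A B := 2 e^{T(supp A) + T(supp B) + 1} ‖A‖∞ ‖B‖∞` (`T(Λ) = ∑_{e ∈ Λ} |x₀(e)|`) such that at every `β ≥ 0`
every rate `M ∈ (0, 1]` admissible on the odd tori `S ≥ S₀` with per-pair constants is re-admissible at rate `M/2`
with the constants `C A B` above a threshold `S₁(β, M, S₀, supp A, supp B)`.

**Proof.** Normalise the pair (`exists_unit_smul_rescale`); translate it by `c := -2 - T(supp A)` so that `A` sits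
in the negative half of the bond reflection `Θ`, and the second observable by a further
`n₀ := T(supp A) + T(supp B) + 2` so that it sits in the positive half (`stub_obsGeometry` (i)–(iii):
`corr(A', B'; m + n₀) = corr(A₂∘Θ, B₁; m)` with `A₁ = A'∘τᶜ`, `A₂ = A₁∘Θ`, `B₁ = B'∘τ^{c+n₀}`, `RpCoreB.ident`);
`A₂`, `B₁` are positive-time with base times `≤ w := 2T(supp A) + 2T(supp B) + 1`; part A
(`RpCoreA.main`: positivity, log-convexity, Cauchy–Schwarz, the chord) applies on the tori `S ≥ 2w + 8` once the
far diagonal values `corr(A₁, A₂; S)`, `corr(B₂, B₁; S)` are bounded by `D e^{-MS}` UNIFORMLY over the sup-norm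
unit balls of the derived boxes — which is the hypothesis upgraded by the landed pair-to-norm principle
(`stub_pairToNorm stub_bilinearUBP`, Banach–Steinhaus; `RpCoreB.far_bound`) — and `S ≥ 2 log D / M`; the offset
`n₀ ≤ 2(T(supp A) + T(supp B) + 1)` and the sup norms go into the constant (`RpCoreB.unit_bound`).

No definitions; landed tree lemmas only. [folklore]
-/

noncomputable section

namespace Summit.QuantumFields.YangMills.Theorems.ContinuumLegGivenGap

open Filter Topology MeasureTheory
open Literature.MathematicalPhysics.QuantumFieldTheory Literature.MathematicalPhysics.QuantumLattice
  Literature.MathematicalPhysics.AQFT Literature.Probability.LatticeModels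

/-! ## Part B — local gauge-invariant observables in reflected position; the RP core -/

namespace RpCoreB

variable {G : Type} [Group G] [TopologicalSpace G] [IsTopologicalGroup G] [CompactSpace G]
  [MeasurableSpace G] [BorelSpace G]

/-- The total absolute time of a box (a natural number dominating `|x₀|` of every link in it). [folklore] -/
theorem natAbs_le_sum {Λ : Finset (Literature.MathematicalPhysics.QuantumLattice.ZdEdge 4)} {e : Literature.MathematicalPhysics.QuantumLattice.ZdEdge 4} (he : e ∈ Λ) :
    (e.1 0).natAbs ≤ ∑ e' ∈ Λ, (e'.1 0).natAbs :=
  Finset.single_le_sum (f := fun e' : Literature.MathematicalPhysics.QuantumLattice.ZdEdge 4 => (e'.1 0).natAbs) (fun _ _ => Nat.zero_le _) he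

/-- Base times of a translated box. [folklore] -/
theorem time_mem_image_shift {Λ : Finset (Literature.MathematicalPhysics.QuantumLattice.ZdEdge 4)} {c : ℤ} {e : Literature.MathematicalPhysics.QuantumLattice.ZdEdge 4}
    (he : e ∈ Λ.image (fun e : Literature.MathematicalPhysics.QuantumLattice.ZdEdge 4 => (e.1 + Pi.single 0 c, e.2))) :
    ∃ e' ∈ Λ, e.1 0 = e'.1 0 + c := by
  obtain ⟨e', he', rfl⟩ := Finset.mem_image.1 he
  exact ⟨e', he', by simp⟩

/-- Base times of a reflected box: `-1 - x₀` (spatial links) or `-2 - x₀` (temporal links). [folklore] -/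
theorem time_mem_image_reflect {Λ : Finset (Literature.MathematicalPhysics.QuantumLattice.ZdEdge 4)} {e : Literature.MathematicalPhysics.QuantumLattice.ZdEdge 4}
    (he : e ∈ Λ.image (fun e : Literature.MathematicalPhysics.QuantumLattice.ZdEdge 4 => if e.2 = 0 then (latticeTimeReflection 4 (e.1 + Pi.single 0 1), 0)
      else (latticeTimeReflection 4 e.1, e.2))) :
    ∃ e' ∈ Λ, e.1 0 = -1 - e'.1 0 ∨ e.1 0 = -2 - e'.1 0 := by
  obtain ⟨e', he', rfl⟩ := Finset.mem_image.1 he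
  refine ⟨e', he', ?_⟩
  by_cases h : e'.2 = 0
  · right
    simp only [h, ↓reduceIte, latticeTimeReflection_apply, Function.update_self, Pi.add_apply,
      Pi.single_eq_same]
    ring
  · left
    simp only [h, ↓reduceIte, latticeTimeReflection_apply, Function.update_self]

variable (r : LatticeRep G)

/-- `K a b ≤ max K 1` for `a, b ∈ [0, 1]`. [folklore] -/
theorem mul_unit_le_max {K a b : ℝ} (ha0 : 0 ≤ a) (ha1 : a ≤ 1) (hb0 : 0 ≤ b) (hb1 : b ≤ 1) :
    K * a * b ≤ max K 1 := by
  rcases le_or_gt 0 K with hK | hK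
  · calc K * a * b ≤ K * 1 * 1 := by gcongr
      _ = K := by ring
      _ ≤ max K 1 := le_max_left _ _
  · have : K * a * b ≤ 0 := by
      have : K * a ≤ 0 := mul_nonpos_of_nonpos_of_nonneg hK.le ha0
      exact mul_nonpos_of_nonpos_of_nonneg this hb0
    exact this.trans (zero_le_one.trans (le_max_right _ _))

omit [Group G] [TopologicalSpace G] [IsTopologicalGroup G] [CompactSpace G] [MeasurableSpace G] [BorelSpace G] in
/-- The supremum of `|A.F|` lies in `[0, 1]` when `|A.F| ≤ 1`. [folklore] -/
theorem iSup_abs_unit {F : LGConfig 4 G → ℝ} (h1 : ∀ U, |F U| ≤ 1) :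
    0 ≤ (⨆ U, |F U|) ∧ (⨆ U, |F U|) ≤ 1 :=
  ⟨Real.iSup_nonneg fun _ => abs_nonneg _, Real.iSup_le h1 zero_le_one⟩

/-- **The far diagonal value, box-uniformly** (the hypothesis' clustering bound at `n = S` for a reflected pair,
with the pair-to-norm upgrade `stub_pairToNorm stub_bilinearUBP`): for boxes `Λa, Λb` there is `D ≥ 1` such that
every pair `(P, Q)` of local gauge-invariant observables on these boxes with `|P.F|, |Q.F| ≤ 1` has
`corr_{β,2S+1}(P, Q; S) ≤ D e^{-MS}` for all `S ≥ S₀`. [folklore] -/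
theorem far_bound {β M : ℝ} {S₀ : ℕ}
    (hadm : ∀ A B : YMSpecies G, ∃ C' : ℝ, ∀ S n : ℕ, S₀ ≤ S → n ≤ S →
      |latticeConnectedCorr r.ρ β (2 * S + 1) A.F B.F n| ≤ C' * Real.exp (-(M * n)))
    (Λa Λb : Finset (Literature.MathematicalPhysics.QuantumLattice.ZdEdge 4)) :
    ∃ D : ℝ, 1 ≤ D ∧ ∀ P Q : YMSpecies G, P.supp = Λa → Q.supp = Λb → (∀ U, |P.F U| ≤ 1) →
      (∀ U, |Q.F U| ≤ 1) → ∀ S : ℕ, S₀ ≤ S →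
        latticeConnectedCorr r.ρ β (2 * S + 1) P.F Q.F S ≤ D * Real.exp (-(M * S)) := by
  obtain ⟨K, hK⟩ := stub_pairToNorm stub_bilinearUBP G r Λa Λb (fun β' S n => β' = β ∧ S₀ ≤ S ∧ n ≤ S)
    (fun _ _ n => Real.exp (-(M * n))) (fun _ _ _ _ => Real.exp_pos _)
    (fun P Q _ _ => by
      obtain ⟨C', hC'⟩ := hadm P Q
      refine ⟨C', fun β' S n h => ?_⟩
      obtain ⟨rfl, hS, hn⟩ := h
      exact hC' S n hS hn)
  refine ⟨max K 1, le_max_right _ _, fun P Q hP hQ hP1 hQ1 S hS => ?_⟩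
  have h := hK P Q hP hQ β S S ⟨rfl, hS, le_rfl⟩
  have hle := (le_abs_self _).trans h
  refine hle.trans (mul_le_mul_of_nonneg_right ?_ (Real.exp_pos _).le)
  obtain ⟨ha0, ha1⟩ := iSup_abs_unit hP1
  obtain ⟨hb0, hb1⟩ := iSup_abs_unit hQ1
  exact mul_unit_le_max ha0 ha1 hb0 hb1

/-- `⌈2 log D / M⌉₊ ≤ S` gives `2 log D ≤ M S`. [folklore] -/
theorem two_log_le {M D : ℝ} (hM : 0 < M) {S : ℕ} (hS : ⌈2 * Real.log D / M⌉₊ ≤ S) :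
    2 * Real.log D ≤ M * S := by
  have h1 : 2 * Real.log D / M ≤ (⌈2 * Real.log D / M⌉₊ : ℝ) := Nat.le_ceil _
  have h2 : (⌈2 * Real.log D / M⌉₊ : ℝ) ≤ S := by exact_mod_cast hS
  have h3 := (div_le_iff₀ hM).1 (h1.trans h2)
  linarith

/-- **Reflected position**: with `A₁ = A' ∘ τᶜ`, `A₂ = A₁ ∘ Θ`, `B₁ = B' ∘ τ^{c+n₀}` one has
`corr(A', B'; m + n₀) = corr(A₂ ∘ Θ, B₁; m)` (simultaneous translation by `c`, then the second observable by
`n₀`; `stub_obsGeometry` (i), (ii); `Θ ∘ Θ = id`). [folklore] -/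
theorem ident {β : ℝ} (A' B' A₁ A₂ B₁ : YMSpecies G) (c : ℤ) (n₀ : ℕ)
    (hA₁F : A₁.F = A'.F ∘ Literature.MathematicalPhysics.QuantumLattice.configShift (-(Pi.single 0 c)))
    (hA₂F : A₂.F = A₁.F ∘ gaugeTimeReflect)
    (hB₁F : B₁.F = B'.F ∘ Literature.MathematicalPhysics.QuantumLattice.configShift (-(Pi.single 0 (c + n₀))))
    (m S : ℕ) :
    latticeConnectedCorr r.ρ β (2 * S + 1) A'.F B'.F (m + n₀) =
      latticeConnectedCorr r.ρ β (2 * S + 1) (A₂.F ∘ gaugeTimeReflect) B₁.F m := by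
  obtain ⟨hgeo1, hgeo2, -, -, -⟩ := stub_obsGeometry G r β
  have hFΘ : A₂.F ∘ gaugeTimeReflect = A₁.F := by
    funext U
    simp only [Function.comp_apply, hA₂F,
      ClusteringToYangMills.Reconstructible.gaugeTimeReflect_gaugeTimeReflect]
  obtain ⟨CA, hCA⟩ := A'.bounded
  obtain ⟨CB, hCB⟩ := B'.bounded
  have hBc_m : Measurable (B'.F ∘ Literature.MathematicalPhysics.QuantumLattice.configShift (-(Pi.single 0 c))) :=
    B'.measurable.comp (Literature.MathematicalPhysics.QuantumLattice.configShift _).measurable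
  have hAc_m : Measurable (A'.F ∘ Literature.MathematicalPhysics.QuantumLattice.configShift (-(Pi.single 0 c))) :=
    A'.measurable.comp (Literature.MathematicalPhysics.QuantumLattice.configShift _).measurable
  have h1 := hgeo1 A'.F B'.F A'.measurable B'.measurable ⟨CA, hCA⟩ ⟨CB, hCB⟩ c S (m + n₀)
  have hAc_b : ∃ C : ℝ, ∀ U, |(A'.F ∘ Literature.MathematicalPhysics.QuantumLattice.configShift (-(Pi.single 0 c))) U| ≤ C :=
    ⟨CA, fun U => hCA _⟩
  have hBc_b : ∃ C : ℝ, ∀ U, |(B'.F ∘ Literature.MathematicalPhysics.QuantumLattice.configShift (-(Pi.single 0 c))) U| ≤ C :=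
    ⟨CB, fun U => hCB _⟩
  have h2 : latticeConnectedCorr r.ρ β (2 * S + 1) (A'.F ∘ Literature.MathematicalPhysics.QuantumLattice.configShift (-(Pi.single 0 c)))
      ((B'.F ∘ Literature.MathematicalPhysics.QuantumLattice.configShift (-(Pi.single 0 c))) ∘ Literature.MathematicalPhysics.QuantumLattice.configShift (-(Pi.single 0 (n₀ : ℤ)))) m =
      latticeConnectedCorr r.ρ β (2 * S + 1) (A'.F ∘ Literature.MathematicalPhysics.QuantumLattice.configShift (-(Pi.single 0 c)))
        (B'.F ∘ Literature.MathematicalPhysics.QuantumLattice.configShift (-(Pi.single 0 c))) (m + n₀) :=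
    hgeo2 _ _ hAc_m hBc_m hAc_b hBc_b n₀ m S
  -- `(B' ∘ τᶜ) ∘ τ^{n₀} = B' ∘ τ^{c+n₀} = B₁.F`
  have hv : (-(Pi.single 0 c) + -(Pi.single 0 (n₀ : ℤ)) : Literature.Probability.LatticeModels.Site 4) =
      -(Pi.single 0 (c + n₀)) := by
    rw [← neg_add, ← Pi.single_add]
  have h3 : (B'.F ∘ Literature.MathematicalPhysics.QuantumLattice.configShift (-(Pi.single 0 c))) ∘
      Literature.MathematicalPhysics.QuantumLattice.configShift (-(Pi.single 0 (n₀ : ℤ))) = B₁.F := by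
    rw [hB₁F]
    funext U
    simp only [Function.comp_apply]
    rw [← Literature.MathematicalPhysics.QuantumFieldTheory.configShift_add', hv]
  rw [hFΘ, hA₁F, ← h1, ← h2, h3]

/-- **The normalised pair**: from the Part-A estimate in reflected position (`|corr(A₂∘Θ, B₁; m)| ≤ 2e^{-(M/2)m}`
for `m ≤ S`) and the identity `ident`, `|corr(A', B'; n)| ≤ 2 e^{n₀/2} e^{-(M/2) n}` for all `n ≤ S` (`M ≤ 1`;
small separations by the a priori bound `2`). [folklore] -/
theorem unit_bound {β M : ℝ} (hM1 : M ≤ 1) (A' B' A₂ B₁ : YMSpecies G) (n₀ S : ℕ)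
    (hA'1 : ∀ U, |A'.F U| ≤ 1) (hB'1 : ∀ U, |B'.F U| ≤ 1)
    (hident : ∀ m : ℕ, latticeConnectedCorr r.ρ β (2 * S + 1) A'.F B'.F (m + n₀) =
      latticeConnectedCorr r.ρ β (2 * S + 1) (A₂.F ∘ gaugeTimeReflect) B₁.F m)
    (hmain : ∀ m : ℕ, m ≤ S →
      |latticeConnectedCorr r.ρ β (2 * S + 1) (A₂.F ∘ gaugeTimeReflect) B₁.F m| ≤ 2 * Real.exp (-(M / 2 * m)))
    (n : ℕ) (hn : n ≤ S) :
    |latticeConnectedCorr r.ρ β (2 * S + 1) A'.F B'.F n| ≤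
      2 * Real.exp ((n₀ : ℝ) / 2) * Real.exp (-(M / 2 * n)) := by
  rcases Nat.lt_or_ge n n₀ with hlt | hge
  · -- small separations: a priori bound
    have h2 : |latticeConnectedCorr r.ρ β (2 * S + 1) A'.F B'.F n| ≤ 2 := by
      have := WilsonBlockHeatBath.abs_latticeConnectedCorr_le_two_mul r β (2 * S + 1) hA'1 hB'1 n
      linarith
    refine h2.trans ?_
    rw [mul_assoc, ← Real.exp_add]
    have hexp : (0 : ℝ) ≤ (n₀ : ℝ) / 2 + -(M / 2 * n) := by
      have hn' : (n : ℝ) ≤ n₀ := by exact_mod_cast hlt.le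
      have hn0 : (0 : ℝ) ≤ n := Nat.cast_nonneg n
      nlinarith
    have := Real.one_le_exp hexp
    linarith
  · obtain ⟨m, rfl⟩ := Nat.exists_eq_add_of_le hge
    rw [Nat.add_comm n₀ m, hident m]
    refine (hmain m (by omega)).trans ?_
    rw [mul_assoc, ← Real.exp_add]
    push_cast
    have : -(M / 2 * m) ≤ (n₀ : ℝ) / 2 + -(M / 2 * ((m : ℝ) + n₀)) := by
      have hn0 : (0 : ℝ) ≤ n₀ := Nat.cast_nonneg n₀
      nlinarith
    gcongr

end RpCoreB

open RpCoreB in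
/-- **`stub_rpCore` — the reflection-positivity core at one coupling** (registered stub of stmt-QuantumFields-15828,
line `Sketch`, reshape 17-RP; replaces the IR stub `stub_twoSidedCore` of reshapes 9–16): at every `(G, r)` there
are β-FREE pair constants `C A B := 2 e^{T(supp A) + T(supp B) + 1} ‖A‖∞ ‖B‖∞` (`T` = total absolute base time of
the box) such that at every `β ≥ 0` every rate `M ∈ (0, 1]` admissible on the tori `S ≥ S₀` with per-pair
constants is re-admissible at rate `M/2` with the constants `C A B` above a β- and box-dependent threshold. Proof:
normalise (`exists_unit_smul_rescale`); translate the pair by `c := -2 - T(supp A)` so that `A` sits in the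
negative half, and the second observable by a further `n₀ := T(supp A) + T(supp B) + 2` so that it sits in the
positive half (`stub_obsGeometry` (i)–(iii)); write `A∘τᶜ = F∘Θ` with `F := A∘τᶜ∘Θ` positive-time
(`stub_obsGeometry` (iv)); Part A (`RpCoreA.main`: positivity, log-convexity and Cauchy–Schwarz from `stub_rpShift` +
`stub_rpFormsCS`, the chord `rpCore_chordBound`) with the far diagonal values controlled box-uniformly by the
hypothesis through the pair-to-norm upgrade (`far_bound`); the offset `n₀` and the norms go into the constant.
[folklore] -/
theorem stub_rpCore :
    ∀ (G : Type) [Group G] [TopologicalSpace G] [IsTopologicalGroup G] [CompactSpace G]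
      [MeasurableSpace G] [BorelSpace G] (r : LatticeRep G),
      ∃ C : YMSpecies G → YMSpecies G → ℝ,
        ∀ (β M : ℝ) (S₀ : ℕ), 0 ≤ β → 0 < M → M ≤ 1 →
          (∀ A B : YMSpecies G, ∃ C' : ℝ, ∀ S n : ℕ, S₀ ≤ S → n ≤ S →
            |latticeConnectedCorr r.ρ β (2 * S + 1) A.F B.F n| ≤ C' * Real.exp (-(M * n))) →
          ∀ Λ₁ Λ₂ : Finset (Literature.MathematicalPhysics.QuantumLattice.ZdEdge 4), ∃ S₁ : ℕ,
            ∀ A B : YMSpecies G, A.supp = Λ₁ → B.supp = Λ₂ → ∀ S n : ℕ, S₁ ≤ S → n ≤ S →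
              |latticeConnectedCorr r.ρ β (2 * S + 1) A.F B.F n| ≤ C A B * Real.exp (-(M / 2 * n)) := by
  intro G _ _ _ _ _ _ r
  refine ⟨fun A B => 2 * Real.exp (((∑ e ∈ A.supp, (e.1 0).natAbs : ℕ) : ℝ) +
    ((∑ e ∈ B.supp, (e.1 0).natAbs : ℕ) : ℝ) + 1) * (⨆ U, |A.F U|) * (⨆ U, |B.F U|), ?_⟩
  intro β M S₀ hβ hM hM1 hadm Λ₁ Λ₂
  obtain ⟨-, -, hgeo3, hgeo4, -⟩ := stub_obsGeometry G r β
  -- box data (kept opaque)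
  obtain ⟨T₁, hT₁⟩ : ∃ T : ℕ, T = ∑ e ∈ Λ₁, (e.1 0).natAbs := ⟨_, rfl⟩
  obtain ⟨T₂, hT₂⟩ : ∃ T : ℕ, T = ∑ e ∈ Λ₂, (e.1 0).natAbs := ⟨_, rfl⟩
  obtain ⟨c, hc⟩ : ∃ c : ℤ, c = -2 - T₁ := ⟨_, rfl⟩
  obtain ⟨n₀, hn₀⟩ : ∃ n : ℕ, n = T₁ + T₂ + 2 := ⟨_, rfl⟩
  obtain ⟨w, hw⟩ : ∃ w : ℕ, w = 2 * T₁ + 2 * T₂ + 1 := ⟨_, rfl⟩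
  -- the four derived boxes
  obtain ⟨Λ₁s, hΛ₁s⟩ : ∃ Λ : Finset (Literature.MathematicalPhysics.QuantumLattice.ZdEdge 4), Λ = Λ₁.image (fun e : Literature.MathematicalPhysics.QuantumLattice.ZdEdge 4 => (e.1 + Pi.single 0 c, e.2)) :=
    ⟨_, rfl⟩
  obtain ⟨Λ₁r, hΛ₁r⟩ : ∃ Λ : Finset (Literature.MathematicalPhysics.QuantumLattice.ZdEdge 4), Λ = Λ₁s.image (fun e : Literature.MathematicalPhysics.QuantumLattice.ZdEdge 4 =>
      if e.2 = 0 then (latticeTimeReflection 4 (e.1 + Pi.single 0 1), 0) else (latticeTimeReflection 4 e.1, e.2)) :=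
    ⟨_, rfl⟩
  obtain ⟨Λ₂s, hΛ₂s⟩ : ∃ Λ : Finset (Literature.MathematicalPhysics.QuantumLattice.ZdEdge 4), Λ = Λ₂.image (fun e : Literature.MathematicalPhysics.QuantumLattice.ZdEdge 4 => (e.1 + Pi.single 0 (c + n₀), e.2)) :=
    ⟨_, rfl⟩
  obtain ⟨Λ₂r, hΛ₂r⟩ : ∃ Λ : Finset (Literature.MathematicalPhysics.QuantumLattice.ZdEdge 4), Λ = Λ₂s.image (fun e : Literature.MathematicalPhysics.QuantumLattice.ZdEdge 4 =>
      if e.2 = 0 then (latticeTimeReflection 4 (e.1 + Pi.single 0 1), 0) else (latticeTimeReflection 4 e.1, e.2)) :=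
    ⟨_, rfl⟩
  -- time bounds of the derived boxes
  have hb₁ : ∀ e ∈ Λ₁, -(T₁ : ℤ) ≤ e.1 0 ∧ e.1 0 ≤ T₁ := fun e he => by
    have hb : (e.1 0).natAbs ≤ T₁ := hT₁ ▸ natAbs_le_sum he
    have hb' : |e.1 0| ≤ (T₁ : ℤ) := by rw [← Int.natCast_natAbs]; exact_mod_cast hb
    exact abs_le.1 hb'
  have hb₂ : ∀ e ∈ Λ₂, -(T₂ : ℤ) ≤ e.1 0 ∧ e.1 0 ≤ T₂ := fun e he => by
    have hb : (e.1 0).natAbs ≤ T₂ := hT₂ ▸ natAbs_le_sum he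
    have hb' : |e.1 0| ≤ (T₂ : ℤ) := by rw [← Int.natCast_natAbs]; exact_mod_cast hb
    exact abs_le.1 hb'
  have htF : ∀ e ∈ Λ₁r, 0 ≤ e.1 0 ∧ e.1 0 ≤ (w : ℤ) := by
    intro e he
    rw [hΛ₁r] at he
    obtain ⟨e₁, he₁, h⟩ := time_mem_image_reflect he
    rw [hΛ₁s] at he₁
    obtain ⟨e₀, he₀, h₀⟩ := time_mem_image_shift he₁
    obtain ⟨hlo, hhi⟩ := hb₁ e₀ he₀
    rcases h with h | h <;> · rw [h, h₀, hc, hw]; push_cast; constructor <;> linarith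
  have htG : ∀ e ∈ Λ₂s, 0 ≤ e.1 0 ∧ e.1 0 ≤ (w : ℤ) := by
    intro e he
    rw [hΛ₂s] at he
    obtain ⟨e₀, he₀, h₀⟩ := time_mem_image_shift he
    obtain ⟨hlo, hhi⟩ := hb₂ e₀ he₀
    rw [h₀, hc, hn₀, hw]; push_cast; constructor <;> linarith
  -- far bounds, box-uniformly
  obtain ⟨DF, hDF1, hDF⟩ := far_bound r hadm Λ₁s Λ₁r
  obtain ⟨DG, hDG1, hDG⟩ := far_bound r hadm Λ₂r Λ₂s
  -- the threshold
  refine ⟨max (max S₀ (2 * w + 8)) (max ⌈2 * Real.log DF / M⌉₊ ⌈2 * Real.log DG / M⌉₊), ?_⟩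
  intro A B hA hB S n hS1 hn
  have hS₀ : S₀ ≤ S := le_trans (le_max_left _ _) ((le_max_left _ _).trans hS1)
  have hSw : 2 * w + 8 ≤ S := le_trans (le_max_right _ _) ((le_max_left _ _).trans hS1)
  have hSF : 2 * Real.log DF ≤ M * S := two_log_le hM (le_trans (le_max_left _ _) ((le_max_right _ _).trans hS1))
  have hSG : 2 * Real.log DG ≤ M * S := two_log_le hM (le_trans (le_max_right _ _) ((le_max_right _ _).trans hS1))
  -- normalise
  obtain ⟨A', hA's, hA'1, hAeq⟩ := exists_unit_smul_rescale A
  obtain ⟨B', hB's, hB'1, hBeq⟩ := exists_unit_smul_rescale B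
  -- the species in reflected position
  obtain ⟨A₁, hA₁F, hA₁s⟩ := hgeo3 A' c
  obtain ⟨A₂, hA₂F, hA₂s⟩ := hgeo4 A₁
  obtain ⟨B₁, hB₁F, hB₁s⟩ := hgeo3 B' (c + n₀)
  obtain ⟨B₂, hB₂F, hB₂s⟩ := hgeo4 B₁
  have hA₁supp : A₁.supp = Λ₁s := by rw [hA₁s, hA's, hA, hΛ₁s]
  have hA₂supp : A₂.supp = Λ₁r := by rw [hA₂s, hA₁supp, hΛ₁r]
  have hB₁supp : B₁.supp = Λ₂s := by rw [hB₁s, hB's, hB, hΛ₂s]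
  have hB₂supp : B₂.supp = Λ₂r := by rw [hB₂s, hB₁supp, hΛ₂r]
  have hA₁1 : ∀ U, |A₁.F U| ≤ 1 := fun U => by rw [hA₁F]; exact hA'1 _
  have hA₂1 : ∀ U, |A₂.F U| ≤ 1 := fun U => by rw [hA₂F]; exact hA₁1 _
  have hB₁1 : ∀ U, |B₁.F U| ≤ 1 := fun U => by rw [hB₁F]; exact hB'1 _
  have hB₂1 : ∀ U, |B₂.F U| ≤ 1 := fun U => by rw [hB₂F]; exact hB₁1 _
  have hFΘ : A₂.F ∘ gaugeTimeReflect = A₁.F := by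
    funext U
    simp only [Function.comp_apply, hA₂F,
      ClusteringToYangMills.Reconstructible.gaugeTimeReflect_gaugeTimeReflect]
  have hGΘ : B₁.F ∘ gaugeTimeReflect = B₂.F := by rw [hB₂F]
  -- far diagonal values
  have hfarF : latticeConnectedCorr r.ρ β (2 * S + 1) (A₂.F ∘ gaugeTimeReflect) A₂.F S ≤
      DF * Real.exp (-(M * S)) := by
    rw [hFΘ]; exact hDF A₁ A₂ hA₁supp hA₂supp hA₁1 hA₂1 S hS₀
  have hfarG : latticeConnectedCorr r.ρ β (2 * S + 1) (B₁.F ∘ gaugeTimeReflect) B₁.F S ≤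
      DG * Real.exp (-(M * S)) := by
    rw [hGΘ]; exact hDG B₂ B₁ hB₂supp hB₁supp hB₂1 hB₁1 S hS₀
  -- Part A on the pair `(A₂.F, B₁.F)`
  have htF' : ∀ e ∈ A₂.supp, 0 ≤ e.1 0 ∧ e.1 0 ≤ (w : ℤ) := by rw [hA₂supp]; exact htF
  have htG' : ∀ e ∈ B₁.supp, 0 ≤ e.1 0 ∧ e.1 0 ≤ (w : ℤ) := by rw [hB₁supp]; exact htG
  have hmain : ∀ m : ℕ, m ≤ S →
      |latticeConnectedCorr r.ρ β (2 * S + 1) (A₂.F ∘ gaugeTimeReflect) B₁.F m| ≤ 2 * Real.exp (-(M / 2 * m)) :=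
    RpCoreA.main r hβ S w hSw A₂.measurable B₁.measurable A₂.bounded B₁.bounded
      A₂.isCylinder B₁.isCylinder htF' htG' hA₂1 hB₁1 hDF1 hDG1 hSF hSG hfarF hfarG
  -- the normalised pair
  have hunit := unit_bound r hM1 A' B' A₂ B₁ n₀ S hA'1 hB'1
    (fun m => ident r A' B' A₁ A₂ B₁ c n₀ hA₁F hA₂F hB₁F m S) hmain n hn
  -- un-normalise
  have hcorr : latticeConnectedCorr r.ρ β (2 * S + 1) A.F B.F n =
      (⨆ V, |A.F V|) * ((⨆ V, |B.F V|) * latticeConnectedCorr r.ρ β (2 * S + 1) A'.F B'.F n) := by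
    conv_lhs => rw [hAeq, hBeq]
    rw [PairToNorm.latticeConnectedCorr_smul_left, PairToNorm.latticeConnectedCorr_smul_right]
  have ha0 : 0 ≤ ⨆ V, |A.F V| := Real.iSup_nonneg fun V => abs_nonneg _
  have hb0 : 0 ≤ ⨆ V, |B.F V| := Real.iSup_nonneg fun V => abs_nonneg _
  rw [hcorr, abs_mul, abs_mul, abs_of_nonneg ha0, abs_of_nonneg hb0]
  have hexp : Real.exp ((n₀ : ℝ) / 2) ≤
      Real.exp (((∑ e ∈ A.supp, (e.1 0).natAbs : ℕ) : ℝ) + ((∑ e ∈ B.supp, (e.1 0).natAbs : ℕ) : ℝ) + 1) := by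
    refine Real.exp_le_exp.2 ?_
    rw [hA, hB, ← hT₁, ← hT₂, hn₀]
    push_cast
    have h1 : (0 : ℝ) ≤ T₁ := Nat.cast_nonneg T₁
    have h2 : (0 : ℝ) ≤ T₂ := Nat.cast_nonneg T₂
    linarith
  calc (⨆ V, |A.F V|) * ((⨆ V, |B.F V|) * |latticeConnectedCorr r.ρ β (2 * S + 1) A'.F B'.F n|)
      ≤ (⨆ V, |A.F V|) * ((⨆ V, |B.F V|) * (2 * Real.exp ((n₀ : ℝ) / 2) * Real.exp (-(M / 2 * n)))) := by
        gcongr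
    _ = 2 * Real.exp ((n₀ : ℝ) / 2) * (⨆ V, |A.F V|) * (⨆ V, |B.F V|) * Real.exp (-(M / 2 * n)) := by ring
    _ ≤ 2 * Real.exp (((∑ e ∈ A.supp, (e.1 0).natAbs : ℕ) : ℝ) + ((∑ e ∈ B.supp, (e.1 0).natAbs : ℕ) : ℝ) + 1) *
          (⨆ V, |A.F V|) * (⨆ V, |B.F V|) * Real.exp (-(M / 2 * n)) := by gcongr

end Summit.QuantumFields.YangMills.Theorems.ContinuumLegGivenGap

end
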